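import Literature.Probability.RandomPlanarGeometry.SAWCylinderMargin
import Literature.Probability.RandomPlanarGeometry.SAWTubeLocalityWidthTwo
import Literature.Probability.RandomPlanarGeometry.SAWStripPolygonLocality
import HarnessLib

/-!
# The cylinder locality window with the leading constant `2π/√3`

Topic `Literature/Probability/RandomPlanarGeometry` (continues `SAWCylinderMargin.lean`: the cylinder
`C_n = ℤ × ℤ_n` in the lift encoding, `μ(C_n) = Zd.cylConnectiveConstant n`, the two-sided window
`Zd.cylinderLocalityWindow : 0 ≤ log μ − log μ(C_n) ≤ 45/√(n−1)` (`n ≥ 3`) and the comparison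
`Zd.tubeConnectiveConstant_le_cylConnectiveConstant : μ(ℤ × {0,…,n−1}) ≤ μ(C_n)`; and
`SAWTubeLocalityWidthTwo.lean`: the strip/slab locality rate at width `2N` with the leading constant
`2π/√3`, `Zd.log_sub_log_tubeConnectiveConstant_le_two_mul`, and its `eventually` form). Source for the
cylinder: G. Grimmett, Z. Li, *Self-avoiding walks and connective constants* (survey, 2019), Theorem 18 (first
alternative, `L ≠ 2`) applied to the cylinder defined in Example 17 (strict inequality `μ(C_n) < μ(ℤ²)`, qualitative; Remark 19 asks for explicit ratios);
locality `μ(C_n) → μ(ℤ²)` is their locality theorem for the Benjamini–Schramm convergent sequence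
`C_n → ℤ²`, again without a rate. The rate below is the tree's (lane pcv-sawmu, item R21 of seat
a-idea-1's ROUTES-G5: "swap the strip bound 45/√T for the door constant"; bookkeeping only).

## What is proved (namespace `Literature.Probability.RandomPlanarGeometry.SAW.Zd`)

* `log_sub_log_cylConnectiveConstant_le_two_mul (hn : 3 ≤ n)`:
  `log μ − log μ(C_n) ≤ (2π/√3)/√(n−2) + 2 (log μ + 13 log(n−1))/(n−2)`;
* `cylinderLocalityWindow_sharp (hn : 3 ≤ n)`: the two-sided window with this upper bound;
* `eventually_log_sub_log_cylConnectiveConstant_le`: for every `η > 0`, eventually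
  `log μ − log μ(C_n) ≤ (2π/√3 + η)/√n`.
-/

noncomputable section

open Filter Topology

namespace Literature.Probability.RandomPlanarGeometry.SAW.Zd

/-- **Cylinder locality with the constant `2π/√3`**: for every `n ≥ 3`,
`log μ(ℤ²) − log μ(ℤ × ℤ_n) ≤ (2π/√3)/√(n−2) + 2 (log μ(ℤ²) + 13 log(n−1))/(n−2)` — the strip of width
`n − 1` inside `C_n` and the width-`2N` strip rate. [cite: GrimmettLi2019Survey, Theorem 18 (first alternative, L ≠ 2), for the cylinder defined in Example 17; explicit rate: this file] -/
theorem log_sub_log_cylConnectiveConstant_le_two_mul {n : ℕ} (hn : 3 ≤ n) :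
    Real.log (connectiveConstant 2) - Real.log (cylConnectiveConstant n) ≤
      2 * Real.pi / Real.sqrt 3 / Real.sqrt ((n : ℝ) - 2) +
        2 * (Real.log (connectiveConstant 2) + 13 * Real.log ((n : ℝ) - 1)) / ((n : ℝ) - 2) := by
  have hstrip := log_sub_log_tubeConnectiveConstant_le_two_mul (d := 2) (k := 1) le_rfl (T := n - 1) (by omega)
  have hle := tubeConnectiveConstant_le_cylConnectiveConstant (n := n) (by omega)
  have hTpos : 0 < tubeConnectiveConstant 2 1 (n - 1) := tubeConnectiveConstant_pos (d := 2) le_rfl _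
  have hlog := Real.log_le_log hTpos hle
  have hcast : ((n - 1 : ℕ) : ℝ) = (n : ℝ) - 1 := by push_cast [Nat.cast_sub (by omega : 1 ≤ n)]; ring
  rw [hcast, show (n : ℝ) - 1 - 1 = (n : ℝ) - 2 by ring] at hstrip
  have e13 : (6 * ((2 : ℕ) : ℝ) + 1) = 13 := by norm_num
  rw [e13] at hstrip
  linarith

/-- **The two-sided cylinder window with the door constant**: for every `n ≥ 3`,
`0 ≤ log μ − log μ(C_n) ≤ (2π/√3)/√(n−2) + 2 (log μ + 13 log(n−1))/(n−2)` (lower bound: strict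
inequality, `cylinderLocalityWindow`; the explicit floor `log(1 + μ^{-4n})/n` is
`log_sub_log_cylConnectiveConstant_ge`). [cite: GrimmettLi2019Survey, Theorem 18 (first alternative, L ≠ 2), Remark 19; explicit rate: this file] -/
theorem cylinderLocalityWindow_sharp {n : ℕ} (hn : 3 ≤ n) :
    0 ≤ Real.log (connectiveConstant 2) - Real.log (cylConnectiveConstant n) ∧
      Real.log (connectiveConstant 2) - Real.log (cylConnectiveConstant n) ≤
        2 * Real.pi / Real.sqrt 3 / Real.sqrt ((n : ℝ) - 2) +
          2 * (Real.log (connectiveConstant 2) + 13 * Real.log ((n : ℝ) - 1)) / ((n : ℝ) - 2) :=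
  ⟨(cylinderLocalityWindow n hn).1, log_sub_log_cylConnectiveConstant_le_two_mul hn⟩

/-- **The leading constant**: for every `η > 0`, for all sufficiently large `n`,
`log μ(ℤ²) − log μ(ℤ × ℤ_n) ≤ (2π/√3 + η)/√n`. [cite: GrimmettLi2019Survey, Theorem 18 (first alternative, L ≠ 2), for the cylinder defined in Example 17; explicit rate: this file] -/
theorem eventually_log_sub_log_cylConnectiveConstant_le {η : ℝ} (hη : 0 < η) :
    ∀ᶠ n : ℕ in atTop, Real.log (connectiveConstant 2) - Real.log (cylConnectiveConstant n) ≤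
      (2 * Real.pi / Real.sqrt 3 + η) / Real.sqrt n := by
  have hc0 : 0 ≤ 2 * Real.pi / Real.sqrt 3 := by positivity
  have hη2 : 0 < η / 2 := by linarith
  -- the strip statement at `T = n - 1` with `η/2`
  have hstrip := eventually_log_sub_log_tubeConnectiveConstant_le_two_mul (d := 2) (k := 1) le_rfl hη2
  have hshift : Tendsto (fun n : ℕ => n - 1) atTop atTop :=
    tendsto_atTop_atTop.2 fun b => ⟨b + 1, fun n hn => by omega⟩
  -- abbreviations `a = c + η/2 < b = c + η`
  obtain ⟨a, ha⟩ : ∃ a : ℝ, a = 2 * Real.pi / Real.sqrt 3 + η / 2 := ⟨_, rfl⟩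
  obtain ⟨b, hb⟩ : ∃ b : ℝ, b = 2 * Real.pi / Real.sqrt 3 + η := ⟨_, rfl⟩
  have ha0 : 0 < a := by rw [ha]; linarith
  have hab : a < b := by rw [ha, hb]; linarith
  have hb0 : 0 < b := by linarith
  have hden : 0 < b ^ 2 - a ^ 2 := by nlinarith
  obtain ⟨N₀, hN₀⟩ := exists_nat_gt (b ^ 2 / (b ^ 2 - a ^ 2))
  filter_upwards [hshift.eventually hstrip, eventually_ge_atTop (max N₀ 3)] with n hn hn3
  have hn3' : 3 ≤ n := le_of_max_le_right hn3
  have hnN : N₀ ≤ n := le_of_max_le_left hn3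
  have hnr : (3 : ℝ) ≤ n := by exact_mod_cast hn3'
  have hle := tubeConnectiveConstant_le_cylConnectiveConstant (n := n) (by omega)
  have hTpos : 0 < tubeConnectiveConstant 2 1 (n - 1) := tubeConnectiveConstant_pos (d := 2) le_rfl _
  have hlog := Real.log_le_log hTpos hle
  have hcast : ((n - 1 : ℕ) : ℝ) = (n : ℝ) - 1 := by push_cast [Nat.cast_sub (by omega : 1 ≤ n)]; ring
  rw [hcast, ← ha] at hn
  rw [← hb]
  -- compare the two right-hand sides: `a/√(n-1) ≤ b/√n` ⇐ `a² n ≤ b² (n-1)`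
  have hs1 : 0 < Real.sqrt ((n : ℝ) - 1) := Real.sqrt_pos.2 (by linarith)
  have hs0 : 0 < Real.sqrt (n : ℝ) := Real.sqrt_pos.2 (by linarith)
  have hcmp : a / Real.sqrt ((n : ℝ) - 1) ≤ b / Real.sqrt n := by
    rw [div_le_div_iff₀ hs1 hs0]
    have hn1 : (0 : ℝ) ≤ (n : ℝ) - 1 := by linarith
    have key : a ^ 2 * n ≤ b ^ 2 * ((n : ℝ) - 1) := by
      have hN : b ^ 2 / (b ^ 2 - a ^ 2) < n := lt_of_lt_of_le hN₀ (by exact_mod_cast hnN)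
      rw [div_lt_iff₀ hden] at hN
      nlinarith
    have h1 : (a * Real.sqrt n) ^ 2 ≤ (b * Real.sqrt ((n : ℝ) - 1)) ^ 2 := by
      rw [mul_pow, mul_pow, Real.sq_sqrt (by linarith), Real.sq_sqrt hn1]
      exact key
    exact (pow_le_pow_iff_left₀ (by positivity) (by positivity) two_ne_zero).1 h1
  linarith

/-- **The cylinder constant halved: `π√(2/3)`** — for every `η > 0`, for all sufficiently large `n`,
`log μ(ℤ²) − log μ(ℤ × ℤ_n) ≤ (π√(2/3) + η)/√n`, through the polygon route for planar strips
(`StripPolygon.stripLocality_eventually`, constant `π√(2/3) = 2.565 < 2π/√3 = 3.628`) and the strip of width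
`n - 1` inside `C_n`. [cite: GrimmettLi2019Survey, Theorem 18 (first alternative, L ≠ 2), for the cylinder defined in Example 17; explicit rate: this file] -/
theorem eventually_log_sub_log_cylConnectiveConstant_le_sharp {η : ℝ} (hη : 0 < η) :
    ∀ᶠ n : ℕ in atTop, Real.log (connectiveConstant 2) - Real.log (cylConnectiveConstant n) ≤
      (Real.pi * Real.sqrt (2 / 3) + η) / Real.sqrt n := by
  have hc0 : 0 ≤ Real.pi * Real.sqrt (2 / 3) := by positivity
  have hη2 : 0 < η / 2 := by linarith
  have hstrip := StripPolygon.stripLocality_eventually hη2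
  have hshift : Tendsto (fun n : ℕ => n - 1) atTop atTop :=
    tendsto_atTop_atTop.2 fun b => ⟨b + 1, fun n hn => by omega⟩
  obtain ⟨a, ha⟩ : ∃ a : ℝ, a = Real.pi * Real.sqrt (2 / 3) + η / 2 := ⟨_, rfl⟩
  obtain ⟨b, hb⟩ : ∃ b : ℝ, b = Real.pi * Real.sqrt (2 / 3) + η := ⟨_, rfl⟩
  have ha0 : 0 < a := by rw [ha]; linarith
  have hab : a < b := by rw [ha, hb]; linarith
  have hb0 : 0 < b := by linarith
  have hden : 0 < b ^ 2 - a ^ 2 := by nlinarith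
  obtain ⟨N₀, hN₀⟩ := exists_nat_gt (b ^ 2 / (b ^ 2 - a ^ 2))
  filter_upwards [hshift.eventually hstrip, eventually_ge_atTop (max N₀ 3)] with n hn hn3
  have hn3' : 3 ≤ n := le_of_max_le_right hn3
  have hnN : N₀ ≤ n := le_of_max_le_left hn3
  have hnr : (3 : ℝ) ≤ n := by exact_mod_cast hn3'
  have hle := tubeConnectiveConstant_le_cylConnectiveConstant (n := n) (by omega)
  have hTpos : 0 < tubeConnectiveConstant 2 1 (n - 1) := tubeConnectiveConstant_pos (d := 2) le_rfl _
  have hlog := Real.log_le_log hTpos hle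
  have hcast : ((n - 1 : ℕ) : ℝ) = (n : ℝ) - 1 := by push_cast [Nat.cast_sub (by omega : 1 ≤ n)]; ring
  rw [hcast, ← ha] at hn
  rw [← hb]
  have hs1 : 0 < Real.sqrt ((n : ℝ) - 1) := Real.sqrt_pos.2 (by linarith)
  have hs0 : 0 < Real.sqrt (n : ℝ) := Real.sqrt_pos.2 (by linarith)
  have hcmp : a / Real.sqrt ((n : ℝ) - 1) ≤ b / Real.sqrt n := by
    rw [div_le_div_iff₀ hs1 hs0]
    have hn1 : (0 : ℝ) ≤ (n : ℝ) - 1 := by linarith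
    have key : a ^ 2 * n ≤ b ^ 2 * ((n : ℝ) - 1) := by
      have hN : b ^ 2 / (b ^ 2 - a ^ 2) < n := lt_of_lt_of_le hN₀ (by exact_mod_cast hnN)
      rw [div_lt_iff₀ hden] at hN
      nlinarith
    have h1 : (a * Real.sqrt n) ^ 2 ≤ (b * Real.sqrt ((n : ℝ) - 1)) ^ 2 := by
      rw [mul_pow, mul_pow, Real.sq_sqrt (by linarith), Real.sq_sqrt hn1]
      exact key
    exact (pow_le_pow_iff_left₀ (by positivity) (by positivity) two_ne_zero).1 h1
  linarith

end Literature.Probability.RandomPlanarGeometry.SAW.Zd
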